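import Summits.QuantumFields.YangMills.Theses.OnsetTautology
import Summits.QuantumFields.YangMills.Theorems.OnsetTautologyOnsetContractionOS
import Summits.QuantumFields.YangMills.Theorems.BalabanLadderInfVolRPSeries
import HarnessLib

/-!
# Route `OnsetTautology`, support `OnsetContraction` (stmt-QuantumFields-28128) PROVED: translating a plaquette atom away
# from the mirror does not increase its reflection-positivity square, in every odd-torus limit state

Route `route-QuantumFields-OnsetTautology` (ideator ym-idea-11 g6, lens «wuc»; bears_on R2a-IV leaf
`InfiniteVolumeContinuum.HypercubicOSDataFromInfiniteVolume`; no summit, leaf or NT statement is proved by this file).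
Width seat ym-t4-w10 g0 (free hands).  THEOREMS ONLY (0 `def`, 0 `sorry`), `--workitem stmt-QuantumFields-28128`.

WHAT IS PROVED (ns `…Theorems.OnsetTautologyOnsetContraction`):
* §3 plaquette atoms `Σ_S w(p)·(P_p − ∫P_p)` over (orientation, site) pairs `p = (q, x)` of `ℤ⁴`: the route's double series
  `Σ' wr(p) wt(p') · stateMomentStr μ 2 (p, p')` is the expectation of a product of two atoms (`tsum_weights_eq_integral`);
  the mirror of an atom is the atom of the mirrored weights (`atom_cfgReflect`: exact plane reflection law
  `InfVolRP.plane_cfgReflect`, plaquette-CENTRE smearing `InfVolRP.smul_reflSite_add_of_centre`); a time translation of an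
  atom is the atom of the translated weights (`atom_configShift`, `InfiniteVolume.plane_add`); the weights of a compactly
  supported profile have finite support (`abs_coord_le_of_ne_zero`).
* §4 ★ **`onsetContraction_proof : Theses.OnsetTautology.OnsetContraction`** — the item, for every compact `G` (the SU(2)
  hypotheses of the item are not used): with the finite centred atom `A` of the offset `y`, the RP square is
  `∫ A(ΘU)·A(U) dμ`, the translated atom is `A ∘ θ_{-m e₀}`, and `OnsetContractionOS.osContraction` applies — site-RP and
  translation invariance of odd-torus limit states are the tree theorems `GaugeBoot.siteRP_zero_of_mem_infiniteVolumeLimitPoints`,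
  `InfiniteVolume.isZdTranslationInvariant_of_mem_oddTorusLimitPoints`.

References: K. Osterwalder, E. Seiler, Ann. Phys. 110 (1978) 440, §2 [OsterwalderSeiler1978]; K. Osterwalder,
R. Schrader, CMP 31 (1973) 83, §2 [OS1973]; J. Glimm, A. Jaffe, Quantum Physics (1987) §6.1.
-/

set_option autoImplicit false

noncomputable section

open scoped BigOperators
open MeasureTheory Filter Topology
open Literature.MathematicalPhysics.QuantumFieldTheory Literature.MathematicalPhysics.QuantumLattice
open Literature.Probability.LatticeModels (Site)
open Summit.QuantumFields.YangMills.Cruxes.OSLegsFromFemtoAndGap.DlrCollarTransfer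
  (plane continuous_plane exists_abs_plane_le)
open Summit.QuantumFields.GaugeBoot (configSiteReflect siteHalfEdges IsReflectionPositiveFor
  siteRP_zero_of_mem_infiniteVolumeLimitPoints)
open Summit.QuantumFields.YangMills.Theorems.InfiniteVolume (stateMomentStr plane_add
  isZdTranslationInvariant_of_mem_oddTorusLimitPoints)
open Summit.QuantumFields.YangMills.Theorems.InfVolRP (reflSite plane_cfgReflect smul_reflSite_add_of_centre
  integral_plane_eq_integral_plane_zero mem_infiniteVolumeLimitPoints_of_mem_oddTorusLimitPoints centreOffset
  two_mul_centreOffset_zero centreOffset_time)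
open Summit.QuantumFields.YangMills.Theorems.OnsetContractionOS (osContraction)

namespace Summit.QuantumFields.YangMills.Theorems.OnsetTautologyOnsetContraction

/-! ## §3 Plaquette atoms: the RP square as an expectation, mirror and shift as re-weightings -/

section Atoms

variable {G : Type} [Group G] [TopologicalSpace G] [IsTopologicalGroup G] [CompactSpace G]
  [MeasurableSpace G] [BorelSpace G]

/-- Reindexing a finite sum by a permutation that preserves the vanishing of the summand off the index set. -/
theorem sum_comp_equiv_of_vanish {ι : Type*} (S : Finset ι) (e : ι ≃ ι) (g : ι → ℝ)
    (hg : ∀ p ∉ S, g p = 0) (hge : ∀ p ∉ S, g (e p) = 0) : ∑ p ∈ S, g (e p) = ∑ p ∈ S, g p := by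
  have h1 : (Function.support fun p => g (e p)) ⊆ (S : Set ι) := fun p hp => by
    by_contra h; exact hp (hge p h)
  have h2 : Function.support g ⊆ (S : Set ι) := fun p hp => by by_contra h; exact hp (hg p h)
  rw [← finsum_eq_sum_of_support_subset _ h1, ← finsum_eq_sum_of_support_subset _ h2]
  exact finsum_comp_equiv e

omit [IsTopologicalGroup G] [CompactSpace G] [BorelSpace G] in
/-- The centred two-point weight `stateMomentStr … 2` is the covariance integral of the two centred plane fields. -/
theorem stateMomentStr_two (r : LatticeRep G) (μ : Measure (LGConfig 4 G)) (q q' : Fin 4 × Fin 4) (x x' : Site 4) :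
    stateMomentStr G r μ 2 ![q, q'] ![x, x'] =
      ∫ U, (plane G r q x U - ∫ V, plane G r q x V ∂μ) * (plane G r q' x' U - ∫ V, plane G r q' x' V ∂μ) ∂μ := by
  unfold stateMomentStr
  simp only [Fin.prod_univ_two, Matrix.cons_val_zero, Matrix.cons_val_one, Matrix.cons_val_fin_one]

omit [IsTopologicalGroup G] [CompactSpace G] [BorelSpace G] in
/-- The centred plane fields are bounded by twice the plane bound. -/
theorem abs_centredPlane_le (r : LatticeRep G) (μ : Measure (LGConfig 4 G)) [IsProbabilityMeasure μ] {Cp : ℝ}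
    (hCp : ∀ (q : Fin 4 × Fin 4) (x : Fin 4 → ℤ) (U : LGConfig 4 G), |plane G r q x U| ≤ Cp)
    (q : Fin 4 × Fin 4) (x : Site 4) (U : LGConfig 4 G) :
    |plane G r q x U - ∫ V, plane G r q x V ∂μ| ≤ 2 * Cp := by
  have h1 : |∫ V, plane G r q x V ∂μ| ≤ Cp := by
    have h := norm_integral_le_of_norm_le_const (μ := μ) (f := plane G r q x) (C := Cp)
      (Eventually.of_forall fun V => by rw [Real.norm_eq_abs]; exact hCp q x V)
    rwa [Real.norm_eq_abs, probReal_univ, mul_one] at h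
  calc |plane G r q x U - ∫ V, plane G r q x V ∂μ| ≤ |plane G r q x U| + |∫ V, plane G r q x V ∂μ| := abs_sub _ _
    _ ≤ Cp + Cp := add_le_add (hCp q x U) h1
    _ = 2 * Cp := by ring

/-- **The RP square of the route as an expectation.**  For weights `u, v` on (orientation, site) pairs vanishing off a
finite set `S`, the route's double series `Σ' u(p) v(p') · stateMomentStr μ 2 (p, p')` is the expectation of the product
of the two finite atoms `Σ_S u(p)·(P_p − ∫P_p)` and `Σ_S v(p)·(P_p − ∫P_p)`. -/
theorem tsum_weights_eq_integral [SecondCountableTopology G] (r : LatticeRep G) (μ : Measure (LGConfig 4 G))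
    [IsProbabilityMeasure μ] (S : Finset ((Fin 4 × Fin 4) × Site 4)) (u v : (Fin 4 × Fin 4) × Site 4 → ℝ)
    (hu : ∀ p ∉ S, u p = 0) (hv : ∀ p ∉ S, v p = 0) :
    ∑' pp : ((Fin 4 × Fin 4) × Site 4) × ((Fin 4 × Fin 4) × Site 4),
        u pp.1 * v pp.2 * stateMomentStr G r μ 2 ![pp.1.1, pp.2.1] ![pp.1.2, pp.2.2] =
      ∫ U, (∑ p ∈ S, u p * (plane G r p.1 p.2 U - ∫ V, plane G r p.1 p.2 V ∂μ)) *
        (∑ p ∈ S, v p * (plane G r p.1 p.2 U - ∫ V, plane G r p.1 p.2 V ∂μ)) ∂μ := by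
  obtain ⟨Cp, hCp⟩ := exists_abs_plane_le (G := G) r
  have hXm : ∀ p : (Fin 4 × Fin 4) × Site 4,
      Measurable fun U => plane G r p.1 p.2 U - ∫ V, plane G r p.1 p.2 V ∂μ := fun p =>
    (continuous_plane r p.1 p.2).measurable.sub measurable_const
  have hXb := abs_centredPlane_le r μ hCp
  have hint : ∀ p p' : (Fin 4 × Fin 4) × Site 4, Integrable (fun U =>
      (u p * v p') * ((plane G r p.1 p.2 U - ∫ V, plane G r p.1 p.2 V ∂μ) *
        (plane G r p'.1 p'.2 U - ∫ V, plane G r p'.1 p'.2 V ∂μ))) μ := by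
    intro p p'
    refine (Integrable.of_bound ((hXm p).mul (hXm p')).aestronglyMeasurable ((2 * Cp) * (2 * Cp))
      (Eventually.of_forall fun U => ?_)).const_mul _
    rw [Real.norm_eq_abs]
    show |(plane G r p.1 p.2 U - ∫ V, plane G r p.1 p.2 V ∂μ) * (plane G r p'.1 p'.2 U - ∫ V, plane G r p'.1 p'.2 V ∂μ)| ≤ _
    rw [abs_mul]
    exact mul_le_mul (hXb _ _ _) (hXb _ _ _) (abs_nonneg _) ((abs_nonneg _).trans (hXb p.1 p.2 U))
  -- the series is a finite sum over `S × S`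
  rw [tsum_eq_sum (s := S ×ˢ S) (fun pp hpp => by
    rw [Finset.mem_product, not_and_or] at hpp
    rcases hpp with h | h
    · rw [hu _ h, zero_mul, zero_mul]
    · rw [hv _ h, mul_zero, zero_mul]), Finset.sum_product]
  -- the expectation of the product of the atoms is the same double sum
  simp_rw [Finset.sum_mul_sum]
  have hterm : ∀ (p p' : (Fin 4 × Fin 4) × Site 4) (U : LGConfig 4 G),
      u p * (plane G r p.1 p.2 U - ∫ V, plane G r p.1 p.2 V ∂μ) * (v p' * (plane G r p'.1 p'.2 U - ∫ V, plane G r p'.1 p'.2 V ∂μ))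
        = (u p * v p') * ((plane G r p.1 p.2 U - ∫ V, plane G r p.1 p.2 V ∂μ) *
          (plane G r p'.1 p'.2 U - ∫ V, plane G r p'.1 p'.2 V ∂μ)) := fun p p' U => by ring
  simp_rw [hterm]
  rw [integral_finsetSum _ (fun p _ => integrable_finsetSum _ fun p' _ => hint p p')]
  refine Finset.sum_congr rfl fun p _ => ?_
  rw [integral_finsetSum _ (fun p' _ => hint p p')]
  refine Finset.sum_congr rfl fun p' _ => ?_
  rw [integral_const_mul, stateMomentStr_two]

/-- The mirror on (orientation, site) pairs: `(q, x) ↦ (q, reflSite q x)`, an involution. -/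
theorem reflPair_involutive : Function.Involutive
    (fun p : (Fin 4 × Fin 4) × Site 4 => ((p.1, reflSite p.1 p.2) : (Fin 4 × Fin 4) × Site 4)) := fun p => by
  simp only [InfVolRP.reflSite_reflSite]

omit [BorelSpace G] in
/-- **The mirror of an atom is the atom of the mirrored weights.**  In a translation-invariant state, for weights `w`
vanishing on invalid orientations and a re-weighting `wρ p = w (p.1, reflSite p.1 p.2)`, both vanishing off `S`:
`Σ_S w(p)·(P_p(ΘU) − ∫P_p) = Σ_S wρ(p)·(P_p(U) − ∫P_p)` (exact plane reflection law `plane_cfgReflect`). -/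
theorem atom_cfgReflect (r : LatticeRep G) {μ : Measure (LGConfig 4 G)} (hTI : IsZdTranslationInvariant μ)
    (S : Finset ((Fin 4 × Fin 4) × Site 4)) (w wρ : (Fin 4 × Fin 4) × Site 4 → ℝ)
    (hvalid : ∀ p, ¬ p.1.1 < p.1.2 → w p = 0) (hwρ : ∀ p, w (p.1, reflSite p.1 p.2) = wρ p)
    (hw : ∀ p ∉ S, w p = 0) (hwρS : ∀ p ∉ S, wρ p = 0) (U : LGConfig 4 G) :
    ∑ p ∈ S, w p * (plane G r p.1 p.2 (cfgReflect U) - ∫ V, plane G r p.1 p.2 V ∂μ) =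
      ∑ p ∈ S, wρ p * (plane G r p.1 p.2 U - ∫ V, plane G r p.1 p.2 V ∂μ) := by
  set ρ : ((Fin 4 × Fin 4) × Site 4) ≃ ((Fin 4 × Fin 4) × Site 4) := reflPair_involutive.toPerm _ with hρ
  have hρapp : ∀ p, ρ p = (p.1, reflSite p.1 p.2) := fun p => rfl
  -- each term: reflection law of the plane field, site-independence of the mean
  have hstep : ∀ p ∈ S, w p * (plane G r p.1 p.2 (cfgReflect U) - ∫ V, plane G r p.1 p.2 V ∂μ) =
      (fun p' => wρ p' * (plane G r p'.1 p'.2 U - ∫ V, plane G r p'.1 p'.2 V ∂μ)) (ρ p) := by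
    intro p _
    by_cases hq : p.1.1 < p.1.2
    · simp only [hρapp, ← hwρ (p.1, reflSite p.1 p.2), InfVolRP.reflSite_reflSite]
      rw [plane_cfgReflect r hq, integral_plane_eq_integral_plane_zero r hTI p.1 p.2,
        integral_plane_eq_integral_plane_zero r hTI p.1 (reflSite p.1 p.2)]
    · have h0 : w p = 0 := hvalid p hq
      have h0' : wρ (ρ p) = 0 := by rw [← hwρ, hρapp]; simp only [InfVolRP.reflSite_reflSite]; exact h0
      simp only [h0, zero_mul, h0']
  rw [Finset.sum_congr rfl hstep]
  refine sum_comp_equiv_of_vanish S ρ (fun p' => wρ p' * (plane G r p'.1 p'.2 U - ∫ V, plane G r p'.1 p'.2 V ∂μ))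
    (fun p hp => by simp only [hwρS p hp, zero_mul]) (fun p hp => ?_)
  have : wρ (ρ p) = w p := by rw [← hwρ, hρapp]; simp only [InfVolRP.reflSite_reflSite]
  simp only [this, hw p hp, zero_mul]

omit [IsTopologicalGroup G] [CompactSpace G] [BorelSpace G] in
/-- **A time translation of an atom is the atom of the translated weights.**  For weights `w` and the re-weighting
`wσ p = w (p.1, p.2 - v)`, both vanishing off `S`: `Σ_S w(p)·(P_p(θ_{-v} U) − ∫P_p) = Σ_S wσ(p)·(P_p(U) − ∫P_p)`. -/
theorem atom_configShift (r : LatticeRep G) {μ : Measure (LGConfig 4 G)} (hTI : IsZdTranslationInvariant μ)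
    (S : Finset ((Fin 4 × Fin 4) × Site 4)) (w wσ : (Fin 4 × Fin 4) × Site 4 → ℝ) (v : Site 4)
    (hwσ : ∀ p, w (p.1, p.2 - v) = wσ p) (hw : ∀ p ∉ S, w p = 0) (hwσS : ∀ p ∉ S, wσ p = 0) (U : LGConfig 4 G) :
    ∑ p ∈ S, w p * (plane G r p.1 p.2 (configShift (-v) U) - ∫ V, plane G r p.1 p.2 V ∂μ) =
      ∑ p ∈ S, wσ p * (plane G r p.1 p.2 U - ∫ V, plane G r p.1 p.2 V ∂μ) := by
  set τ : ((Fin 4 × Fin 4) × Site 4) ≃ ((Fin 4 × Fin 4) × Site 4) :=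
    Equiv.prodCongr (Equiv.refl _) (Equiv.addRight v) with hτ
  have hτapp : ∀ p, τ p = (p.1, p.2 + v) := fun p => rfl
  have hstep : ∀ p ∈ S, w p * (plane G r p.1 p.2 (configShift (-v) U) - ∫ V, plane G r p.1 p.2 V ∂μ) =
      (fun p' => wσ p' * (plane G r p'.1 p'.2 U - ∫ V, plane G r p'.1 p'.2 V ∂μ)) (τ p) := by
    intro p _
    simp only [hτapp, ← hwσ (p.1, p.2 + v), add_sub_cancel_right]
    rw [← plane_add r p.1 p.2 v, integral_plane_eq_integral_plane_zero r hTI p.1 p.2,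
      integral_plane_eq_integral_plane_zero r hTI p.1 (p.2 + v)]
  rw [Finset.sum_congr rfl hstep]
  refine sum_comp_equiv_of_vanish S τ (fun p' => wσ p' * (plane G r p'.1 p'.2 U - ∫ V, plane G r p'.1 p'.2 V ∂μ))
    (fun p hp => by simp only [hwσS p hp, zero_mul]) (fun p hp => ?_)
  have : wσ (τ p) = w p := by rw [← hwσ, hτapp]; simp only [add_sub_cancel_right]
  simp only [this, hw p hp, zero_mul]

/-- **Finite support of the atoms**: if `b` vanishes off the ball of radius `R`, a weight `b (w - z)` with
`‖w‖ = ‖s • (siteToE x + o)‖`, `‖o‖ ≤ 1`, `s > 0`, can be non-zero only for `|x i| ≤ (R + ‖z‖)/s + 1`. -/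
theorem abs_coord_le_of_ne_zero {b : EuclideanSpace ℝ (Fin 4) → ℝ} {R : ℝ}
    (hbR : Function.support b ⊆ Metric.closedBall 0 R) {s : ℝ} (hs : 0 < s) {o : EuclideanSpace ℝ (Fin 4)}
    (ho : ‖o‖ ≤ 1) (x : Site 4) (z w : EuclideanSpace ℝ (Fin 4)) (hw : ‖w‖ = ‖s • (siteToE x + o)‖)
    (h : b (w - z) ≠ 0) (i : Fin 4) : |(x i : ℝ)| ≤ (R + ‖z‖) / s + 1 := by
  have hmem : w - z ∈ Metric.closedBall (0 : EuclideanSpace ℝ (Fin 4)) R := hbR h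
  rw [Metric.mem_closedBall, dist_zero_right] at hmem
  have h1 : ‖w‖ ≤ R + ‖z‖ := by
    have := norm_le_norm_add_norm_sub' w z  -- ‖w‖ ≤ ‖z‖ + ‖w - z‖ ?
    linarith [norm_sub_rev w z]
  rw [hw, norm_smul, Real.norm_eq_abs, abs_of_pos hs] at h1
  have h2 : ‖siteToE x‖ ≤ ‖siteToE x + o‖ + 1 := by
    have := norm_sub_le (siteToE x + o) o
    rw [add_sub_cancel_right] at this
    linarith
  have h3 : ‖siteToE x + o‖ ≤ (R + ‖z‖) / s := by
    rw [le_div_iff₀ hs]; linarith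
  have h4 : |(x i : ℝ)| ≤ ‖siteToE x‖ := by
    have h := PiLp.norm_apply_le (siteToE x) i
    rwa [siteToE_apply, Real.norm_eq_abs] at h
  linarith

end Atoms

/-! ## §4 The support item -/

/-- **`OnsetContraction` (stmt-QuantumFields-28128) PROVED.**  In every odd-torus limit state at `β ≥ 0`, translating the
atom `Σ_{q ∈ Q, x} b(s(x + o_q) − y)·P_q(x)` of a compactly supported positive-time profile `b` UP by `m` lattice units
does not increase its reflection-positivity square.  Proof: the RP square is `∫ A(ΘU)·A(U) dμ` for the finite centred
atom `A` (exact plane reflection law for plaquette-centre smearing, `InfVolRP.smul_reflSite_add_of_centre`); the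
translated atom is `A ∘ θ_{-m e₀}`; site-RP of torus limit states (`GaugeBoot.siteRP_zero_of_mem_infiniteVolumeLimitPoints`),
translation invariance, and the Osterwalder–Seiler contraction `osContraction`.  (The SU(2) hypotheses of the item are not
used: the statement holds for every compact `G`.) [cite: OsterwalderSeiler1978, §2; OS1973, §2] -/
theorem onsetContraction_proof : Summit.QuantumFields.YangMills.Theses.OnsetTautology.OnsetContraction := by
  intro G _ _ _ _ _hG _hSU r β μ b Q s y m wt wr rpSq hβ hμ hb hbsupp hs hy
  letI : MeasurableSpace G := borel G
  haveI : BorelSpace G := ⟨rfl⟩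
  haveI : SecondCountableTopology G := r.secondCountableTopology
  haveI : T2Space G := r.t2Space
  -- the state: probability, translation invariant, site-RP
  have hμ' := mem_infiniteVolumeLimitPoints_of_mem_oddTorusLimitPoints r hμ
  obtain ⟨-, -, hprob, -⟩ := id hμ'
  have hTI : IsZdTranslationInvariant μ := isZdTranslationInvariant_of_mem_oddTorusLimitPoints r hμ
  have hRP : IsReflectionPositiveFor (configSiteReflect (G := G) 0) (siteHalfEdges 0) μ :=
    siteRP_zero_of_mem_infiniteVolumeLimitPoints r.ρ r.continuous hβ hμ'
  -- the translated offset
  set y' : EuclideanSpace ℝ (Fin 4) := y + (s * (m : ℝ)) • EuclideanSpace.single 0 (1 : ℝ) with hy'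
  set v : Site 4 := Pi.single 0 (m : ℤ) with hv
  -- a box containing the support of all four weight functions
  obtain ⟨R, hR⟩ : ∃ R : ℝ, Function.support (b : EuclideanSpace ℝ (Fin 4) → ℝ) ⊆ Metric.closedBall 0 R := by
    obtain ⟨R, hR⟩ := (hb.isCompact.isBounded).subset_closedBall (0 : EuclideanSpace ℝ (Fin 4))
    exact ⟨R, (subset_tsupport _).trans hR⟩
  set B : ℕ := ⌈(R + (‖y‖ + s * m)) / s + 1⌉₊ with hB
  set S : Finset ((Fin 4 × Fin 4) × Site 4) :=
    Finset.univ ×ˢ Fintype.piFinset (fun _ : Fin 4 => Finset.Icc (-(B : ℤ)) B) with hS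
  have hy'norm : ‖y'‖ ≤ ‖y‖ + s * m := by
    rw [hy']
    refine (norm_add_le _ _).trans (add_le_add le_rfl ?_)
    rw [norm_smul, PiLp.norm_single, norm_one, mul_one, Real.norm_eq_abs, abs_of_nonneg (by positivity)]
  have hmemS : ∀ (x : Site 4) (q : Fin 4 × Fin 4), (∀ i, |(x i : ℝ)| ≤ (R + (‖y‖ + s * m)) / s + 1) → (q, x) ∈ S := by
    intro x q hx
    simp only [hS, Finset.mem_product, Finset.mem_univ, true_and, Fintype.mem_piFinset, Finset.mem_Icc]
    intro i
    have h1 : |(x i : ℝ)| ≤ (B : ℝ) := (hx i).trans (Nat.le_ceil _)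
    have h2 : |x i| ≤ (B : ℤ) := by exact_mod_cast h1
    exact abs_le.1 h2
  -- vanishing of the weights off `S`, for an offset `z` with `‖z‖ ≤ ‖y‖ + s m`
  have hvanish : ∀ z : EuclideanSpace ℝ (Fin 4), ‖z‖ ≤ ‖y‖ + s * m →
      (∀ p ∉ S, wt z p = 0) ∧ (∀ p ∉ S, wr z p = 0) := by
    intro z hz
    have key : ∀ (p : (Fin 4 × Fin 4) × Site 4) (w : EuclideanSpace ℝ (Fin 4)),
        ‖w‖ = ‖s • (siteToE p.2 + centreOffset p.1)‖ → p ∉ S → b (w - z) = 0 := by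
      intro p w hw hp
      by_contra hne
      refine hp (hmemS p.2 p.1 fun i => ?_)
      have h := abs_coord_le_of_ne_zero hR hs (InfVolRP.norm_centreOffset_le_one p.1) p.2 z w hw hne i
      have hmono : (R + ‖z‖) / s + 1 ≤ (R + (‖y‖ + s * m)) / s + 1 := by
        have := div_le_div_of_nonneg_right (c := s) (by linarith : R + ‖z‖ ≤ R + (‖y‖ + s * m)) hs.le
        linarith
      exact h.trans hmono
    refine ⟨fun p hp => ?_, fun p hp => ?_⟩
    · show (if p.1 ∈ Q ∧ p.1.1 < p.1.2 then b (s • (siteToE p.2 + centreOffset p.1) - z) else 0) = 0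
      rw [key p _ rfl hp, ite_self]
    · show (if p.1 ∈ Q ∧ p.1.1 < p.1.2 then b (timeReflection 4 (s • (siteToE p.2 + centreOffset p.1)) - z) else 0) = 0
      rw [key p _ (LinearIsometryEquiv.norm_map _ _) hp, ite_self]
  obtain ⟨hwtS, hwrS⟩ := hvanish y (by linarith [mul_nonneg hs.le (Nat.cast_nonneg m)])
  obtain ⟨hwtS', hwrS'⟩ := hvanish y' hy'norm
  -- the mirror identity `wt z (q, reflSite q x) = wr z (q, x)` (plaquette-centre smearing)
  have hmirror : ∀ (z : EuclideanSpace ℝ (Fin 4)) (p : (Fin 4 × Fin 4) × Site 4),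
      wt z (p.1, reflSite p.1 p.2) = wr z p := by
    intro z p
    show (if p.1 ∈ Q ∧ p.1.1 < p.1.2 then b (s • (siteToE (reflSite p.1 p.2) + centreOffset p.1) - z) else 0) =
      (if p.1 ∈ Q ∧ p.1.1 < p.1.2 then b (timeReflection 4 (s • (siteToE p.2 + centreOffset p.1)) - z) else 0)
    by_cases hq : p.1 ∈ Q ∧ p.1.1 < p.1.2
    · rw [if_pos hq, if_pos hq, smul_reflSite_add_of_centre s p.1 p.2 _ (two_mul_centreOffset_zero hq.2)]
    · rw [if_neg hq, if_neg hq]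
  -- the shift identity `wt y (q, x - v) = wt y' (q, x)`
  have hshift : ∀ p : (Fin 4 × Fin 4) × Site 4, wt y (p.1, p.2 - v) = wt y' p := by
    intro p
    show (if p.1 ∈ Q ∧ p.1.1 < p.1.2 then b (s • (siteToE (p.2 - v) + centreOffset p.1) - y) else 0) =
      (if p.1 ∈ Q ∧ p.1.1 < p.1.2 then b (s • (siteToE p.2 + centreOffset p.1) - y') else 0)
    have hpt : s • (siteToE (p.2 - v) + centreOffset p.1) - y = s • (siteToE p.2 + centreOffset p.1) - y' := by
      rw [hy', hv]
      ext i
      simp only [PiLp.sub_apply, PiLp.smul_apply, PiLp.add_apply, siteToE_apply, Pi.sub_apply, smul_eq_mul,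
        PiLp.single_apply]
      by_cases hi : i = 0
      · subst hi; simp only [Pi.single_eq_same, ↓reduceIte]; push_cast; ring
      · simp only [Pi.single_eq_of_ne hi, hi, ↓reduceIte]; push_cast; ring
    rw [hpt]
  -- the weights vanish on invalid orientations
  have hvalid : ∀ (z : EuclideanSpace ℝ (Fin 4)) (p : (Fin 4 × Fin 4) × Site 4), ¬ p.1.1 < p.1.2 → wt z p = 0 := by
    intro z p hq
    show (if p.1 ∈ Q ∧ p.1.1 < p.1.2 then b (s • (siteToE p.2 + centreOffset p.1) - z) else 0) = 0
    rw [if_neg (fun h => hq h.2)]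
  -- the atom `A` of `y` and its three avatars
  have hsq : ∀ z : EuclideanSpace ℝ (Fin 4), (∀ p ∉ S, wt z p = 0) → (∀ p ∉ S, wr z p = 0) →
      rpSq z = ∫ U, (∑ p ∈ S, wt z p * (plane G r p.1 p.2 (cfgReflect U) - ∫ V, plane G r p.1 p.2 V ∂μ)) *
        (∑ p ∈ S, wt z p * (plane G r p.1 p.2 U - ∫ V, plane G r p.1 p.2 V ∂μ)) ∂μ := by
    intro z hzt hzr
    show (∑' pp : ((Fin 4 × Fin 4) × Site 4) × ((Fin 4 × Fin 4) × Site 4),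
        wr z pp.1 * wt z pp.2 * stateMomentStr G r μ 2 ![pp.1.1, pp.2.1] ![pp.1.2, pp.2.2]) = _
    rw [tsum_weights_eq_integral r μ S (wr z) (wt z) hzr hzt]
    refine integral_congr_ae (Eventually.of_forall fun U => ?_)
    simp only
    rw [atom_cfgReflect r hTI S (wt z) (wr z) (hvalid z) (hmirror z) hzt hzr U]
  -- the atom of `y'` is the atom of `y` translated up by `m`
  have hA' : ∀ U : LGConfig 4 G, (∑ p ∈ S, wt y' p * (plane G r p.1 p.2 U - ∫ V, plane G r p.1 p.2 V ∂μ)) =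
      ∑ p ∈ S, wt y p * (plane G r p.1 p.2 (configShift (-v) U) - ∫ V, plane G r p.1 p.2 V ∂μ) := fun U =>
    (atom_configShift r hTI S (wt y) (wt y') v hshift hwtS hwtS' U).symm
  -- properties of the atom `A`
  obtain ⟨Cp, hCp⟩ := exists_abs_plane_le (G := G) r
  have hAm : Measurable fun U => ∑ p ∈ S, wt y p * (plane G r p.1 p.2 U - ∫ V, plane G r p.1 p.2 V ∂μ) :=
    Finset.measurable_sum _ fun p _ => ((continuous_plane r p.1 p.2).measurable.sub measurable_const).const_mul _
  have hAb : ∃ C, ∀ U, |∑ p ∈ S, wt y p * (plane G r p.1 p.2 U - ∫ V, plane G r p.1 p.2 V ∂μ)| ≤ C := by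
    refine ⟨∑ p ∈ S, |wt y p| * (2 * Cp), fun U => (Finset.abs_sum_le_sum_abs _ _).trans
      (Finset.sum_le_sum fun p _ => ?_)⟩
    rw [abs_mul]
    exact mul_le_mul_of_nonneg_left (abs_centredPlane_le r μ hCp p.1 p.2 U) (abs_nonneg _)
  have htime : ∀ p : (Fin 4 × Fin 4) × Site 4, wt y p ≠ 0 → 0 ≤ p.2 0 := by
    intro p hp
    have hp' : (if p.1 ∈ Q ∧ p.1.1 < p.1.2 then b (s • (siteToE p.2 + centreOffset p.1) - y) else 0) ≠ 0 := hp
    rw [ne_eq, ite_eq_right_iff, Classical.not_imp] at hp'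
    obtain ⟨-, hne⟩ := hp'
    have hmem : s • (siteToE p.2 + centreOffset p.1) - y ∈ {u : EuclideanSpace ℝ (Fin 4) | 0 < u 0} :=
      hbsupp (subset_tsupport _ hne)
    simp only [Set.mem_setOf_eq, PiLp.sub_apply, PiLp.smul_apply, PiLp.add_apply, siteToE_apply, smul_eq_mul] at hmem
    have ho := centreOffset_time p.1
    by_contra hneg
    push Not at hneg
    have h1 : (p.2 0 : ℝ) ≤ -1 := by exact_mod_cast (show p.2 0 ≤ -1 by omega)
    have h2 : (p.2 0 : ℝ) + centreOffset p.1 0 < 0 := by linarith [ho.2]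
    have h3 : s * ((p.2 0 : ℝ) + centreOffset p.1 0) < 0 := mul_neg_of_pos_of_neg hs h2
    linarith
  have hAd : DependsOn (fun U => ∑ p ∈ S, wt y p * (plane G r p.1 p.2 U - ∫ V, plane G r p.1 p.2 V ∂μ))
      (siteHalfEdges (d := 4) 0) := by
    intro U W hUW
    refine Finset.sum_congr rfl fun p _ => ?_
    by_cases hp : wt y p = 0
    · simp only [hp, zero_mul]
    · rw [InfVolRP.dependsOn_plane r p.1 (htime p hp) hUW]
  -- assemble
  rw [hsq y' hwtS' hwrS', hsq y hwtS hwrS]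
  simp_rw [hA']
  exact osContraction hRP hTI hAm hAb hAd m

end Summit.QuantumFields.YangMills.Theorems.OnsetTautologyOnsetContraction

end
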